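import Mathlib
import HarnessLib
import Summits.ResolutionOfSingularities.ResolutionOfSingularities.Theorems.WildQuotientsWildQuotientResolutionKSCentreFixedPoint

/-!
# Kollár–Szabó going down, (K2-centres), p-CLOSED stabilisers: the equivariant monoidal transform and the fixed
# point on blow-ups along a regular stable centre for `I ⊵ P ⊇ [I,I]` (Lemma A.1 shape)
# (crux `WildQuotients.WildQuotientResolution`, stub `stub_phaseZeroHighDim`)

Crux stmt-ResolutionOfSingularities-15640 (`WildQuotientResolution`), registered stub `stub_phaseZeroHighDim`;
programme PHASE0-KS-EIGENLINE, item (K2-centres). The abelian chain ✓`KSCentreEigenline` → ✓`KSCentreAdaptedGenerators`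
→ ✓`KSCentreMonoidalTransform` → ✓`KSCentreEquivariantChart` (p830814) → ✓`KSCentreFixedPoint` (p830862) re-run for
the stabilisers the Phase-0 game actually meets: a finite group `I` with a NORMAL `p`-subgroup `P` containing all
commutators (`I` p-closed with abelian tame part — hand 8-g2's ★ orbit theorem's generality), residue field
algebraically closed of characteristic `p`. Only the eigen-covector source changes
(✓`CentreEigenline.exists_stable_hyperplane_of_normal_isPGroup`, Kollár–Szabó Lemma A.1 via ✓`PClosedEigenline`):

* `CentreEigenline.exists_adapted_generators_of_stable_centre_of_normal_isPGroup` — adapted coordinates + stable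
  hyperplane + unit eigenvalues;
* `CentreChart.exists_equivariant_monoidalTransform_of_action_of_normal_isPGroup` — the REGULAR `σ`-stable monoidal
  transform `R ⊆ Frac A` with `J R = (t)`, residue-trivial `α_g`, same residue field;
* ★ `CentreChart.exists_fixedPoint_liftAction_of_regularCentre_of_normal_isPGroup` — on ANY blow-up along a REGULAR
  `σ`-stable centre through `x` (`I_x ≠ 0` generated by part of a regular system of parameters) with the lifted action:
  a point `x'` over `x` with `g ∈ I_{x'}` for every `g`, with its regular chart `(R, ι, t, φ)`.

[OURS · crux stmt-ResolutionOfSingularities-15640 · helper toward `stub_phaseZeroHighDim` ((K2-centres), p-closed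
variant; NOT a proof of the stub); counted 0; AI-level work, weaker than expert review.]
[cite: ReichsteinYoussin2000, Appendix (Kollár–Szabó), Lemma A.1 and proof of Prop. A.2]
-/

-- single-problem summit: the doubled namespace component `ResolutionOfSingularities` is forced
set_option linter.dupNamespace false

noncomputable section

open CategoryTheory CategoryTheory.Limits AlgebraicGeometry TopologicalSpace IsLocalRing
open Literature.AlgebraicGeometry.Ramification Literature.AlgebraicGeometry.Resolution
open Scheme.IdealSheafData
open Summit.ResolutionOfSingularities.ResolutionOfSingularities.Theorems.WildQuotientResolution

namespace Summit.ResolutionOfSingularities.ResolutionOfSingularities.Theorems.WildQuotientResolution.CentreEigenline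

/-- **Adapted coordinates for a p-CLOSED stabiliser of a stable centre** (`I ⊵ P` a normal `p`-subgroup containing the
commutators; `κ` algebraically closed of characteristic `p`): coordinates `x'` (`(x') = 𝔪`, `x' = x` off `range e`,
`(x' ∘ e) = J`), an index `i`, and a `τ`-STABLE ideal `W` with `𝔪J ≤ W ≤ J`, `x' (e j) ∈ W` (`j ≠ i`),
`W ≤ (x' (e j) : j ≠ i) + 𝔪J`, `x' (e i) ∉ W`, and unit eigenvalues `τ_g (x' (e i)) − u_g x' (e i) ∈ W`.
[cite: ReichsteinYoussin2000, Appendix, Lemma A.1 and proof of Prop. A.2] -/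
theorem exists_adapted_generators_of_stable_centre_of_normal_isPGroup {A : Type*} [CommRing A] [IsLocalRing A]
    [IsNoetherianRing A] {p : ℕ} [Fact p.Prime] [CharP (ResidueField A) p] [IsAlgClosed (ResidueField A)]
    {I : Type*} [Group I] [Finite I] (P : Subgroup I) [P.Normal] (hP : IsPGroup p P)
    (hcomm : ∀ g h : I, g * h * g⁻¹ * h⁻¹ ∈ P)
    (τ : I →* (A ≃+* A)) (hres : ∀ (g : I) (a : A), τ g a - a ∈ maximalIdeal A)
    {d m : ℕ} (x : Fin d → A) (hx : Ideal.span (Set.range x) = maximalIdeal A)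
    (e : Fin m → Fin d) (he : Function.Injective e)
    (hJ0 : Ideal.span (Set.range (x ∘ e)) ≠ ⊥)
    (hJ : ∀ g : I, ∀ a ∈ Ideal.span (Set.range (x ∘ e)), τ g a ∈ Ideal.span (Set.range (x ∘ e))) :
    ∃ (x' : Fin d → A) (i : Fin m) (W : Ideal A), Ideal.span (Set.range x') = maximalIdeal A ∧
      Ideal.span (Set.range (x' ∘ e)) = Ideal.span (Set.range (x ∘ e)) ∧
      (∀ k : Fin d, k ∉ Set.range e → x' k = x k) ∧
      maximalIdeal A * Ideal.span (Set.range (x ∘ e)) ≤ W ∧ W ≤ Ideal.span (Set.range (x ∘ e)) ∧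
      x' (e i) ∉ W ∧ (∀ j : Fin m, j ≠ i → x' (e j) ∈ W) ∧
      W ≤ Ideal.span ((x' ∘ e) '' {j | j ≠ i}) ⊔ maximalIdeal A * Ideal.span (Set.range (x ∘ e)) ∧
      (∀ g : I, ∀ w ∈ W, τ g w ∈ W) ∧
      ∀ g : I, ∃ u : A, IsUnit u ∧ τ g (x' (e i)) - u * x' (e i) ∈ W := by
  set J : Ideal A := Ideal.span (Set.range (x ∘ e)) with hJdef
  obtain ⟨W, hWJ, hWle, hWne, hsup, hstab⟩ :=
    exists_stable_hyperplane_of_normal_isPGroup τ hres P hP hcomm J hJ0 hJ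
  obtain ⟨t, htJ, htW⟩ : ∃ t ∈ J, t ∉ W := SetLike.exists_of_lt (lt_of_le_of_ne hWle hWne)
  obtain ⟨x', i, hx', hx'J, hx'i, hx'W, hWle', hx'off⟩ :=
    exists_generators_adapted_to_hyperplane x hx e he W hWJ hWle htJ htW (hsup t htJ htW)
  refine ⟨x', i, W, hx', hx'J, hx'off, hWJ, hWle, by rw [hx'i]; exact htW, hx'W, hWle', hstab, fun g => ?_⟩
  rw [hx'i]
  exact exists_unit_mul_sub_mem_of_not_mem τ J hJ W hWJ hstab htJ htW (hsup t htJ htW) g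

end Summit.ResolutionOfSingularities.ResolutionOfSingularities.Theorems.WildQuotientResolution.CentreEigenline

namespace Summit.ResolutionOfSingularities.ResolutionOfSingularities.Theorems.WildQuotientResolution.CentreChart

universe u

/-- **The equivariant monoidal transform of a regular local domain along a stable regular centre, p-CLOSED stabiliser.**
Let `A` be a regular local domain with algebraically closed residue field, `x : Fin d → A` a regular system of
parameters (`(x) = 𝔪`, `d` the embedding dimension), `e : Fin m → Fin d` injective with `J = (x ∘ e) ≠ 0` — a
regular centre through the closed point — and let a finite group `I ⊵ P` (`P` a normal `p`-subgroup containing the commutators; `κ(A) = κ̄` of characteristic `p`)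
act on `A` by ring automorphisms `τ_g` with `τ_g a − a ∈ 𝔪_A` and `τ_g J ⊆ J`. Then there are: a local subring `R` of `K = Frac A`, REGULAR, an injective
local ring map `ι : A → R` (the inclusion), an element `t ∈ R`, `t ≠ 0`, with `J · R = (t)`, and ring
endomorphisms `α_g` of `R` with `α_g ∘ ι = ι ∘ τ_g` and `α_g r − r ∈ 𝔪_R`; and every `r ∈ R` is congruent modulo
`𝔪_R` to some `ι a`. This is the Kollár–Szabó fixed point `[W]` of the blow-up of `Spec A` along `V(J)` over the
closed point, as a local ring with its induced action. [cite: ReichsteinYoussin2000, Appendix, Lemma A.1 and proof of Prop. A.2]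
[cite: Liu2002, Thm. 8.1.19 (a)] -/
theorem exists_equivariant_monoidalTransform_of_action_of_normal_isPGroup {A : Type u} [CommRing A] [IsDomain A]
    [IsRegularLocalRing A] {p : ℕ} [Fact p.Prime] [CharP (ResidueField A) p] [IsAlgClosed (ResidueField A)]
    {d m : ℕ} (hd : (maximalIdeal A).spanFinrank = d) (x : Fin d → A)
    (hx : Ideal.span (Set.range x) = maximalIdeal A) (e : Fin m → Fin d) (he : Function.Injective e)
    (hJ0 : Ideal.span (Set.range (x ∘ e)) ≠ ⊥)
    {I : Type*} [Group I] [Finite I] (P : Subgroup I) [P.Normal] (hP : IsPGroup p P)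
    (hcomm : ∀ g h : I, g * h * g⁻¹ * h⁻¹ ∈ P)
    (τ : I →* (A ≃+* A)) (hres : ∀ (g : I) (a : A), τ g a - a ∈ maximalIdeal A)
    (hJ : ∀ g : I, ∀ a ∈ Ideal.span (Set.range (x ∘ e)), τ g a ∈ Ideal.span (Set.range (x ∘ e))) :
    ∃ (R : Subring (FractionRing A)) (_ : IsLocalRing R) (ι : A →+* R) (_ : IsLocalHom ι) (t : R)
      (α : I → (R →+* R)),
      IsRegularLocalRing R ∧
      (∀ a : A, ((ι a : R) : FractionRing A) = algebraMap A (FractionRing A) a) ∧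
      Function.Injective ι ∧ t ≠ 0 ∧ (Ideal.span (Set.range (x ∘ e))).map ι = Ideal.span {t} ∧
      (∀ g : I, (α g).comp ι = ι.comp (τ g : A →+* A)) ∧
      (∀ (g : I) (r : R), α g r - r ∈ maximalIdeal R) ∧
      (∀ r : R, ∃ a : A, ι a - r ∈ maximalIdeal R) := by
  -- verbatim `exists_equivariant_monoidalTransform_of_action` with the p-closed hyperplane source
  classical
  -- the model `S = image of A` in `K = Frac A`
  let K := FractionRing A
  let f : A →+* K := algebraMap A K
  have hf : Function.Injective f := IsFractionRing.injective A K
  let S : Subring K := f.range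
  have hrr : Function.Injective f.rangeRestrict := fun a b h => hf (congrArg Subtype.val h)
  let e₀ : A ≃+* S := RingEquiv.ofBijective f.rangeRestrict ⟨hrr, RingHom.rangeRestrict_surjective f⟩
  have he₀ : ∀ a : A, ((e₀ a : S) : K) = f a := fun a => rfl
  haveI : IsRegularLocalRing S := IsRegularLocalRing.of_ringEquiv e₀
  haveI : IsAlgClosed (ResidueField S) :=
    IsAlgClosed.of_ringEquiv (ResidueField A) (ResidueField S) (ResidueField.mapEquiv e₀)
  haveI : CharP (ResidueField S) p :=
    charP_of_injective_ringHom (f := (ResidueField.mapEquiv e₀).toRingHom) (ResidueField.mapEquiv e₀).injective p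
  have heS : ∀ (s : S), ∃ a : A, s = e₀ a := fun s => ⟨e₀.symm s, (e₀.apply_symm_apply s).symm⟩
  -- the transported coordinates
  let xS : Fin d → S := fun k => e₀ (x k)
  have hmapx : (Ideal.span (Set.range x)).map (e₀ : A →+* S) = Ideal.span (Set.range xS) := by
    rw [Ideal.map_span, ← Set.range_comp]
    rfl
  have hxS : Ideal.span (Set.range xS) = maximalIdeal S := by
    rw [← hmapx, hx]
    exact map_ringEquiv_maximalIdeal e₀
  have hdS : (maximalIdeal S).spanFinrank = d := by
    rw [← map_ringEquiv_maximalIdeal e₀, Ideal.spanFinrank_map_eq_of_ringEquiv, hd]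
  have hmapJ : (Ideal.span (Set.range (x ∘ e))).map (e₀ : A →+* S) = Ideal.span (Set.range (xS ∘ e)) := by
    rw [Ideal.map_span, ← Set.range_comp]
    rfl
  have hmemJS : ∀ s : S, s ∈ Ideal.span (Set.range (xS ∘ e)) ↔ e₀.symm s ∈ Ideal.span (Set.range (x ∘ e)) := by
    intro s
    rw [← hmapJ, Ideal.map_comap_of_equiv, Ideal.mem_comap]
  have hJS0 : Ideal.span (Set.range (xS ∘ e)) ≠ ⊥ := by
    intro h0
    apply hJ0
    rw [← Ideal.map_eq_bot_iff_of_injective (f := (e₀ : A →+* S)) e₀.injective, hmapJ, h0]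
  -- the transported action on `S` and the extended action on `K`
  obtain ⟨τS, hτS⟩ := KSGoingDown.exists_transport_action e₀ τ
  have hresS : ∀ (g : I) (s : S), τS g s - s ∈ maximalIdeal S :=
    KSGoingDown.transport_residueTrivial e₀ τ hres τS hτS
  have hJS : ∀ g : I, ∀ s ∈ Ideal.span (Set.range (xS ∘ e)), τS g s ∈ Ideal.span (Set.range (xS ∘ e)) := by
    intro g s hs
    rw [hmemJS] at hs ⊢
    rw [hτS, e₀.symm_apply_apply]
    exact hJ g _ hs
  let σK : I → (K ≃+* K) := fun g => IsFractionRing.ringEquivOfRingEquiv (τ g)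
  have hσK : ∀ (g : I) (a : A), σK g (f a) = f (τ g a) := fun g a =>
    IsFractionRing.ringEquivOfRingEquiv_algebraMap (τ g) a
  have hσS : ∀ g : I, ∀ s ∈ S, σK g s ∈ S := by
    rintro g _ ⟨a, rfl⟩
    exact ⟨τ g a, (hσK g a).symm⟩
  have hσS' : ∀ (g : I) (s : S), (⟨σK g s, hσS g s s.2⟩ : S) = τS g s := by
    intro g s
    obtain ⟨a, rfl⟩ := heS s
    apply Subtype.ext
    change σK g (f a) = ((τS g (e₀ a) : S) : K)
    rw [hσK, hτS, e₀.symm_apply_apply, he₀]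
  -- adapted coordinates `x'`, the stable hyperplane `W`, unit eigenvalues (hand 8-g3, ✓`KSCentreAdaptedGenerators`)
  obtain ⟨x', i, W, hx', hx'J, -, hWJ, hWle, hti, hx'W, hWle', hstab, hunit⟩ :=
    CentreEigenline.exists_adapted_generators_of_stable_centre_of_normal_isPGroup P hP hcomm τS hresS xS hxS e he
      hJS0 hJS
  -- the centre coordinates `y = x' ∘ e`, `t = y i`
  let y : Fin m → S := fun j => x' (e j)
  have hyJ' : Ideal.span (Set.range y) = Ideal.span (Set.range (xS ∘ e)) := hx'J
  have hyi : y i ≠ 0 := by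
    intro h
    apply hti
    change y i ∈ W
    rw [h]
    exact W.zero_mem
  have hym : ∀ j, y j ∈ maximalIdeal S := fun j => hx' ▸ Ideal.subset_span ⟨e j, rfl⟩
  have hqr : IsQuasiRegular y := isQuasiRegular_rsop_comp hdS x' hx' e he
  have hWle'' : W ≤ Ideal.span (y '' {j | j ≠ i}) ⊔ maximalIdeal S * Ideal.span (Set.range y) := by
    rw [hyJ']
    exact hWle'
  have hres' : ∀ (g : I) (s : S), (⟨σK g s, hσS g s s.2⟩ : S) - s ∈ maximalIdeal S := fun g s => by
    rw [hσS']
    exact hresS g s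
  have hWσ : ∀ (g : I) (j : Fin m), j ≠ i → (⟨σK g ((y j : S) : K), hσS g _ (y j).2⟩ : S) ∈ W :=
    fun g j hj => by
    rw [hσS']
    exact hstab g _ (hx'W j hj)
  have ht' : ∀ g : I, ∃ u : S, IsUnit u ∧ (⟨σK g ((y i : S) : K), hσS g _ (y i).2⟩ : S) - u * y i ∈ W :=
    fun g => by
    rw [hσS']
    exact hunit g
  -- hand 8-g3: the stable monoidal transform
  obtain ⟨R₁, hSR, hdom, htinv, hJR, -, hstabR, hresR, hcongR, hregR⟩ :=
    exists_equivariant_monoidalTransform S y hqr hym i hyi hWle'' σK hσS hres' hWσ ht'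
  have hreg : IsRegularLocalRing R₁.toSubring :=
    hregR (isRegularRing_closure_monoidalChart S hdS x' hx' e he i)
  -- the structure map `ι : A → R₁`
  let ι : A →+* R₁.toSubring := (Subring.inclusion hSR).comp (e₀ : A →+* S)
  have hι : ∀ a : A, ((ι a : R₁.toSubring) : K) = f a := fun a => rfl
  have hιinj : Function.Injective ι := fun a b h => hf (by rw [← hι, ← hι, h])
  haveI hloc : IsLocalHom ι := by
    refine ⟨fun a ha => ?_⟩
    obtain ⟨h0, hinv⟩ := (isUnit_subring_iff_inv_mem (ι a)).mp ha
    rw [hι] at h0 hinv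
    have hnot : e₀ a ∉ maximalIdeal S := fun hm => by
      rcases (hdom (e₀ a)).mp hm with h | h
      · exact h0 h
      · exact h hinv
    have hu : IsUnit (e₀ a) := by
      by_contra hu
      exact hnot ((IsLocalRing.mem_maximalIdeal _).mpr (mem_nonunits_iff.mpr hu))
    simpa using hu.map e₀.symm
  -- the element `t = y i` read in `R₁` and `J R₁ = (t)`
  let tR : R₁.toSubring := ⟨((y i : S) : K), hSR (y i).2⟩
  have htR0 : tR ≠ 0 := by
    intro h
    have h' : ((y i : S) : K) = 0 := congrArg Subtype.val h
    exact hyi (Subtype.ext h')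
  have hyi0 : ((y i : S) : K) ≠ 0 := fun h => hyi (Subtype.ext h)
  have hmap : (Ideal.span (Set.range (x ∘ e))).map ι = Ideal.span {tR} := by
    change (Ideal.span (Set.range (x ∘ e))).map ((Subring.inclusion hSR).comp (e₀ : A →+* S)) = _
    rw [← Ideal.map_map, hmapJ, ← hyJ', Ideal.map_span]
    apply le_antisymm
    · refine Ideal.span_le.mpr ?_
      rintro _ ⟨_, ⟨j, rfl⟩, rfl⟩
      have hq : ((y j : S) : K) / ((y i : S) : K) ∈ R₁.toSubring := hJR (y j) (Ideal.subset_span ⟨j, rfl⟩)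
      refine Ideal.mem_span_singleton'.mpr ⟨⟨_, hq⟩, Subtype.ext ?_⟩
      change ((y j : S) : K) / ((y i : S) : K) * ((y i : S) : K) = ((y j : S) : K)
      exact div_mul_cancel₀ _ hyi0
    · refine Ideal.span_le.mpr ?_
      rintro _ rfl
      exact Ideal.subset_span ⟨y i, ⟨i, rfl⟩, rfl⟩
  -- the restricted endomorphisms
  let α : I → (R₁.toSubring →+* R₁.toSubring) := fun g => (σK g : K →+* K).restrict _ _ (hstabR g)
  have hα : ∀ (g : I) (r : R₁.toSubring), ((α g r : R₁.toSubring) : K) = σK g r := fun g r => rfl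
  refine ⟨R₁.toSubring, inferInstance, ι, hloc, tR, α, hreg, hι, hιinj, htR0, hmap, fun g => ?_,
    fun g r => ?_, fun r => ?_⟩
  · ext a
    change σK g (f a) = f (τ g a)
    exact hσK g a
  · rw [mem_maximalIdeal_iff_inv_not_mem]
    have e1 : ((α g r - r : R₁.toSubring) : K) = σK g r - r := by rw [AddSubgroupClass.coe_sub, hα]
    rw [e1]
    exact hresR g r r.2
  · obtain ⟨s, hs, hrs⟩ := hcongR r r.2
    obtain ⟨a, ha⟩ := heS ⟨s, hs⟩
    have ha : ((e₀ a : S) : K) = s := (congrArg Subtype.val ha).symm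
    refine ⟨a, ?_⟩
    have e2 : ι a - r = -(r - ι a) := by ring
    rw [e2]
    refine neg_mem_iff.mpr ?_
    rw [mem_maximalIdeal_iff_inv_not_mem]
    have e3 : ((r - ι a : R₁.toSubring) : K) = (r : K) - s := by
      rw [AddSubgroupClass.coe_sub, hι, ← he₀, ← ha]
    rw [e3]
    exact hrs


/-- **The fixed point of the blow-up along a regular stable centre, p-CLOSED stabiliser (Kollár–Szabó Lemma A.1 shape).**
Let `X` be an integral scheme, `G ⊵ P` a finite group with a normal `p`-subgroup containing the commutators acting on `X` with `g ∈ I_x` for all `g` at a point `x` whose local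
ring is regular with algebraically closed residue field of characteristic `p`, `I` a `σ`-stable ideal sheaf whose stalk `I_x ≠ 0` is
generated by part `xs ∘ e` of a regular system of parameters `xs` of `𝒪_{X,x}` (a REGULAR centre through `x`), and
`π : X' → X` a blowing up along `I`, with the lifted action (✓`IsBlowup.liftAction`). Then there are a REGULAR local
subring `R ⊆ Frac 𝒪_{X,x}` with an injective local structure map `ι`, `I_x R = (t)` for some `t ≠ 0`, and the same
residue field — the equivariant monoidal transform at the stable normal hyperplane — a morphism `φ : Spec R → X'`
over `Spec R → Spec 𝒪_{X,x} → X`, and the point `x' = φ(closed point) ∈ X'` over `x`, such that every `g` lies in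
the inertia group of the lifted action at `x'`.
[cite: ReichsteinYoussin2000, Appendix (Kollár–Szabó), Lemma A.1 and proof of Prop. A.2] -/
theorem exists_fixedPoint_liftAction_of_regularCentre_of_normal_isPGroup {X : Scheme.{0}} [IsIntegral X]
    {G : Type} [Group G] [Finite G] {p : ℕ} [Fact p.Prime] (P : Subgroup G) [P.Normal] (hP : IsPGroup p P)
    (hcomm : ∀ g h : G, g * h * g⁻¹ * h⁻¹ ∈ P)
    (σ : G →* Aut X) {x : X} (hGx : ∀ g, g ∈ inertiaSubgroup σ x)
    [IsRegularLocalRing (X.presheaf.stalk x)] [CharP (ResidueField (X.presheaf.stalk x)) p]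
    [IsAlgClosed (ResidueField (X.presheaf.stalk x))]
    {I : X.IdealSheafData} (hI : ∀ g, I.comap (σ g).hom = I)
    {d m : ℕ} (hd : (maximalIdeal (X.presheaf.stalk x)).spanFinrank = d) (xs : Fin d → X.presheaf.stalk x)
    (hxs : Ideal.span (Set.range xs) = maximalIdeal (X.presheaf.stalk x))
    (e : Fin m → Fin d) (he : Function.Injective e)
    (hIx : stalkIdeal I x = Ideal.span (Set.range (xs ∘ e))) (hIx0 : stalkIdeal I x ≠ ⊥)
    {X' : Scheme.{0}} {π : X' ⟶ X} (hπ : IsBlowup π I) :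
    ∃ (R : Subring (FractionRing (X.presheaf.stalk x))) (_ : IsLocalRing R)
      (ι : X.presheaf.stalk x →+* R) (_ : IsLocalHom ι) (t : R) (φ : Spec (.of R) ⟶ X') (x' : X'),
      IsRegularLocalRing R ∧
      (∀ a, ((ι a : R) : FractionRing (X.presheaf.stalk x)) =
        algebraMap (X.presheaf.stalk x) (FractionRing (X.presheaf.stalk x)) a) ∧
      Function.Injective ι ∧ t ≠ 0 ∧ (stalkIdeal I x).map ι = Ideal.span {t} ∧
      (∀ r : R, ∃ a, ι a - r ∈ maximalIdeal R) ∧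
      φ ≫ π = Spec.map (CommRingCat.ofHom ι) ≫ X.fromSpecStalk x ∧ φ (closedPoint R) = x' ∧ π x' = x ∧
      ∀ g, g ∈ inertiaSubgroup (hπ.liftAction σ hI) x' := by
  -- verbatim `exists_fixedPoint_liftAction_of_regularCentre` with the action re-indexed by `G` and the p-closed glue
  -- the stalk action of `G = I_x`, its residue-triviality and the stability of `I_x`
  obtain ⟨a, τ, hkey, hτ⟩ := PointBlowupStalkData.exists_stalkAction σ x (⊤ : Subgroup G)
    (fun g _ => apply_eq_of_mem_inertiaSubgroup σ (hGx g))
  have htop : (⊤ : Subgroup G) ≤ inertiaSubgroup σ x := fun g _ => hGx g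
  have hresO : ∀ (g : (⊤ : Subgroup G)) (s : X.presheaf.stalk x), τ g s - s ∈ maximalIdeal _ :=
    InertLocusStalk.stalkAction_residueTrivial σ x a τ hkey hτ htop
  have hstabI : ∀ (g : (⊤ : Subgroup G)), ∀ r ∈ stalkIdeal I x, (a g).hom r ∈ stalkIdeal I x :=
    stalkIdeal_stable_of_stalkAction σ ⊤ (fun g _ => apply_eq_of_mem_inertiaSubgroup σ (hGx g)) a hkey hI
  have hJτ : ∀ g : (⊤ : Subgroup G), ∀ r ∈ Ideal.span (Set.range (xs ∘ e)),
      τ g r ∈ Ideal.span (Set.range (xs ∘ e)) := by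
    intro g r hr
    rw [← hIx] at hr ⊢
    rw [hτ]
    exact hstabI g⁻¹ r hr
  have hJ0 : Ideal.span (Set.range (xs ∘ e)) ≠ ⊥ := hIx ▸ hIx0
  -- the action re-indexed by `G` itself, and the p-closed equivariant monoidal transform
  let τG : G →* (X.presheaf.stalk x ≃+* X.presheaf.stalk x) := τ.comp Subgroup.topEquiv.symm.toMonoidHom
  have hτG : ∀ g, τG g = τ ⟨g, Subgroup.mem_top g⟩ := fun g => rfl
  have hresG : ∀ (g : G) (s : X.presheaf.stalk x), τG g s - s ∈ maximalIdeal _ := fun g s => by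
    rw [hτG]; exact hresO ⟨g, Subgroup.mem_top g⟩ s
  have hJτG : ∀ g : G, ∀ r ∈ Ideal.span (Set.range (xs ∘ e)), τG g r ∈ Ideal.span (Set.range (xs ∘ e)) :=
    fun g r hr => by rw [hτG]; exact hJτ ⟨g, Subgroup.mem_top g⟩ r hr
  obtain ⟨R, hRloc, ι, hιloc, t, α, hreg, hι, hιinj, ht0, hmap, hα, hres, hcong⟩ :=
    exists_equivariant_monoidalTransform_of_action_of_normal_isPGroup hd xs hxs e he hJ0 P hP hcomm τG hresG hJτG
  -- repackage over `G`
  let a' : G → (X.presheaf.stalk x ⟶ X.presheaf.stalk x) := fun g => a ⟨g, Subgroup.mem_top g⟩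
  have hkey' : ∀ g, Spec.map (a' g) ≫ X.fromSpecStalk x = X.fromSpecStalk x ≫ (σ g).hom := fun g =>
    hkey ⟨g, Subgroup.mem_top g⟩
  let α' : G → (R →+* R) := fun g => α g⁻¹
  have hα' : ∀ g, (α' g).comp ι = ι.comp (a' g).hom := by
    intro g
    have hinv : (⟨g⁻¹, Subgroup.mem_top _⟩ : (⊤ : Subgroup G))⁻¹ = ⟨g, Subgroup.mem_top g⟩ :=
      Subtype.ext (inv_inv g)
    refine (hα g⁻¹).trans ?_
    ext s
    change ((ι (τ ⟨g⁻¹, Subgroup.mem_top _⟩ s) : R) : FractionRing (X.presheaf.stalk x)) =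
      ((ι ((a ⟨g, Subgroup.mem_top g⟩).hom s) : R) : FractionRing (X.presheaf.stalk x))
    rw [hτ, hinv]
  have hres' : ∀ (g : G) (r : R), α' g r - r ∈ maximalIdeal R := fun g r => hres _ r
  have htnz : t ∈ nonZeroDivisors R := mem_nonZeroDivisors_of_ne_zero ht0
  have hmapI : (stalkIdeal I x).map ι = Ideal.span {t} := by rw [hIx]; exact hmap
  -- the local chart and its fixed point
  obtain ⟨φ, x', hφ, hφx', hx'x, hinert⟩ :=
    KSGoingDown.exists_fixedPoint_liftAction_of_localChart_of_stalkIdeal hπ σ hI a' hkey' ι htnz hmapI α'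
      hα' hres'
  exact ⟨R, hRloc, ι, hιloc, t, φ, x', hreg, hι, hιinj, ht0, hmapI, hcong, hφ, hφx', hx'x, hinert⟩

end Summit.ResolutionOfSingularities.ResolutionOfSingularities.Theorems.WildQuotientResolution.CentreChart

end
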